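import Summits.ValiantsHypothesis.ValiantsHypothesis.Theorems.BorderApolarityFixedWitnessObstructionQPNecessity

/-!
# Crux `FixedWitnessObstructionQP` (stmt-ValiantsHypothesis-5778): the windowed de-bordering stub makes the toric line exact

Route `ValiantsHypothesis/BorderApolarity`, crux item `stmt-ValiantsHypothesis-5778`, line
`toric-face-debordering`; sequel to `…QPNecessity.lean` (the J-free residue *NoExtremalInitialFormQP*,
its equivalence with the crux given `ToricFixedPoints`, and the necessity of the external dc-stub).
Kernel-checked bookkeeping for the tenure planner: the registered open stub `stub_toricDeborderQP`
quantifies over all sizes `3 ≤ n ≤ m`, but only its WINDOWED restriction is used, and with that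
restriction the line's residue is EQUIVALENT to the crux (given stmt-5779) — no overshoot.
-/

open MvPolynomial Filter
open scoped BigOperators Matrix Topology
open Literature.Computability.AlgebraicComplexity
open Summit.ValiantsHypothesis.ValiantsHypothesis.Theses
open Summit.ValiantsHypothesis.ValiantsHypothesis.Theses.BorderApolarity

-- the mandated summit-side namespace `Summit.ValiantsHypothesis.ValiantsHypothesis.…`
-- (single-problem summit: summit name = problem name) repeats a component by design
set_option linter.dupNamespace false

namespace Summit.ValiantsHypothesis.ValiantsHypothesis.Theorems.BorderApolarityFixedWitnessObstructionQP

/-! ## The windowed de-bordering stub makes the skeleton exact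

`stub_toricDeborderQP` quantifies over ALL `3 ≤ n ≤ m`; only its restriction to the window is ever
used.  The WINDOWED form *ToricDeborderQPWindow* — "there is `c₁` such that for every `c`, for all
large `n` and every `m` with `n ≤ m ≤ 2^((log₂ n + c)^c)`, an extremal initial-form representation of
`X₀₀^(m-n) per_n` by a translate of `det_m` forces `dc(per_n) ≤ 2^((log₂ m + c₁)^c₁)`" — is implied
by the thesis (vacuously: `toricDeborderQPWindow_of_gctThesis`), still suffices together with the
eventual dc-stub (`noExtremalInitialForm_of_toricDeborderQPWindow`), and therefore, given
`ToricFixedPoints`, the pair (windowed de-bordering, eventual super-qp `dc(per_n)`) is EQUIVALENT to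
the crux (`fixedWitnessObstructionQP_iff_toricDeborderQPWindow_and_dc`): with this repair the toric
line's residue is exactly as strong as its target, whereas the unwindowed `stub_toricDeborderQP` is a
statement about all sizes `m` (toric border ⇒ affine at quasi-polynomial cost everywhere) that the
crux does not imply. -/

/-- **The thesis implies the windowed de-bordering stub**, vacuously (with `c₁ = 0`): under
`GCTMult.GctThesis` no extremal initial-form representation exists in the window
(`noExtremalInitialForm_of_gctThesis`). [folklore] -/
theorem toricDeborderQPWindow_of_gctThesis (hG : GCTMult.GctThesis) :
    ∃ c₁ : ℕ, ∀ c : ℕ, ∃ n₀ : ℕ, ∀ n ≥ n₀, ∀ (m : ℕ) [NeZero m], n ≤ m →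
      m ≤ 2 ^ ((Nat.log 2 n + c) ^ c) →
      (∃ (u g : Matrix.GeneralLinearGroup (Fin m × Fin m) ℂ) (w : Fin m × Fin m → ℕ) (e : ℕ),
        (∀ d ∈ (linSubst (Fin m × Fin m) ℂ (g : Matrix (Fin m × Fin m) (Fin m × Fin m) ℂ)
          (detPoly (Fin m) ℂ)).support, Finsupp.weight w d ≤ e) ∧
        paddedPerPoly ℂ n m =
          linSubst (Fin m × Fin m) ℂ (u : Matrix (Fin m × Fin m) (Fin m × Fin m) ℂ)
            (MvPolynomial.weightedHomogeneousComponent w e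
              (linSubst (Fin m × Fin m) ℂ (g : Matrix (Fin m × Fin m) (Fin m × Fin m) ℂ)
                (detPoly (Fin m) ℂ)))) →
      determinantalComplexity (perPoly (Fin n) ℂ) ≤ 2 ^ ((Nat.log 2 m + c₁) ^ c₁) := by
  refine ⟨0, fun c => ?_⟩
  obtain ⟨n₀, hn₀⟩ := noExtremalInitialForm_of_gctThesis hG c
  refine ⟨n₀, fun n hn m _ hnm hm hrep => ?_⟩
  exact (hn₀ n hn m hnm hm hrep).elim

/-- **Windowed de-bordering ∧ eventual super-qp `dc(per_n)` ⟹ no extremal initial form in the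
window**: given `c`, take `n₂` from the windowed stub at `c`, `c'` from `qp_absorb c c₁ 1 1` and `n₁`
from `hdc c'`; threshold `max n₂ n₁`. [folklore] -/
theorem noExtremalInitialForm_of_toricDeborderQPWindow
    (hTDW : ∃ c₁ : ℕ, ∀ c : ℕ, ∃ n₀ : ℕ, ∀ n ≥ n₀, ∀ (m : ℕ) [NeZero m], n ≤ m →
      m ≤ 2 ^ ((Nat.log 2 n + c) ^ c) →
      (∃ (u g : Matrix.GeneralLinearGroup (Fin m × Fin m) ℂ) (w : Fin m × Fin m → ℕ) (e : ℕ),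
        (∀ d ∈ (linSubst (Fin m × Fin m) ℂ (g : Matrix (Fin m × Fin m) (Fin m × Fin m) ℂ)
          (detPoly (Fin m) ℂ)).support, Finsupp.weight w d ≤ e) ∧
        paddedPerPoly ℂ n m =
          linSubst (Fin m × Fin m) ℂ (u : Matrix (Fin m × Fin m) (Fin m × Fin m) ℂ)
            (MvPolynomial.weightedHomogeneousComponent w e
              (linSubst (Fin m × Fin m) ℂ (g : Matrix (Fin m × Fin m) (Fin m × Fin m) ℂ)
                (detPoly (Fin m) ℂ)))) →
      determinantalComplexity (perPoly (Fin n) ℂ) ≤ 2 ^ ((Nat.log 2 m + c₁) ^ c₁))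
    (hdc : ∀ c : ℕ, ∃ n₀ : ℕ, ∀ n ≥ n₀,
      2 ^ ((Nat.log 2 n + c) ^ c) < determinantalComplexity (perPoly (Fin n) ℂ)) :
    ∀ c : ℕ, ∃ n₀ : ℕ, ∀ n ≥ n₀, ∀ (m : ℕ) [NeZero m], n ≤ m → m ≤ 2 ^ ((Nat.log 2 n + c) ^ c) →
      ¬ ∃ (u g : Matrix.GeneralLinearGroup (Fin m × Fin m) ℂ) (w : Fin m × Fin m → ℕ) (e : ℕ),
        (∀ d ∈ (linSubst (Fin m × Fin m) ℂ (g : Matrix (Fin m × Fin m) (Fin m × Fin m) ℂ)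
          (detPoly (Fin m) ℂ)).support, Finsupp.weight w d ≤ e) ∧
        paddedPerPoly ℂ n m =
          linSubst (Fin m × Fin m) ℂ (u : Matrix (Fin m × Fin m) (Fin m × Fin m) ℂ)
            (MvPolynomial.weightedHomogeneousComponent w e
              (linSubst (Fin m × Fin m) ℂ (g : Matrix (Fin m × Fin m) (Fin m × Fin m) ℂ)
                (detPoly (Fin m) ℂ))) := by
  obtain ⟨c₁, hTDW⟩ := hTDW
  intro c
  obtain ⟨n₂, hn₂⟩ := hTDW c
  obtain ⟨c', hc'⟩ := qp_absorb c c₁ 1 1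
  obtain ⟨n₁, hn₁⟩ := hdc c'
  refine ⟨max n₂ n₁, ?_⟩
  intro n hn m inst hnm hm hw
  have hn₂' : n₂ ≤ n := le_trans (le_max_left _ _) hn
  have hn₁' : n₁ ≤ n := le_trans (le_max_right _ _) hn
  have hdc' := @hn₂ n hn₂' m inst hnm hm hw
  have hle := hc' n m hm
  have hlt := hn₁ n hn₁'
  have hB : 2 ^ ((Nat.log 2 m + c₁) ^ c₁) ≤
      1 * ((m + 1) * (2 ^ ((Nat.log 2 m + c₁) ^ c₁) + 1)) ^ 1 := by
    rw [one_mul, pow_one]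
    nlinarith [Nat.zero_le m, Nat.zero_le (2 ^ ((Nat.log 2 m + c₁) ^ c₁))]
  exact (lt_irrefl _ (hlt.trans_le ((hdc'.trans hB).trans hle))).elim

/-- **With the windowed repair the toric line is exact**: given `ToricFixedPoints` (stmt-5779), the
crux `FixedWitnessObstructionQP` is EQUIVALENT to the conjunction of the windowed de-bordering stub
and the eventual super-quasi-polynomial growth of `dc(per_n)` (`→`: both conjuncts follow from the
crux through the thesis; `←`: `noExtremalInitialForm_of_toricDeborderQPWindow` and
`fixedWitnessObstructionQP_of_noExtremalInitialForm`). [folklore] -/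
theorem fixedWitnessObstructionQP_iff_toricDeborderQPWindow_and_dc (hT : ToricFixedPoints) :
    FixedWitnessObstructionQP ↔
    ((∃ c₁ : ℕ, ∀ c : ℕ, ∃ n₀ : ℕ, ∀ n ≥ n₀, ∀ (m : ℕ) [NeZero m], n ≤ m →
      m ≤ 2 ^ ((Nat.log 2 n + c) ^ c) →
      (∃ (u g : Matrix.GeneralLinearGroup (Fin m × Fin m) ℂ) (w : Fin m × Fin m → ℕ) (e : ℕ),
        (∀ d ∈ (linSubst (Fin m × Fin m) ℂ (g : Matrix (Fin m × Fin m) (Fin m × Fin m) ℂ)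
          (detPoly (Fin m) ℂ)).support, Finsupp.weight w d ≤ e) ∧
        paddedPerPoly ℂ n m =
          linSubst (Fin m × Fin m) ℂ (u : Matrix (Fin m × Fin m) (Fin m × Fin m) ℂ)
            (MvPolynomial.weightedHomogeneousComponent w e
              (linSubst (Fin m × Fin m) ℂ (g : Matrix (Fin m × Fin m) (Fin m × Fin m) ℂ)
                (detPoly (Fin m) ℂ)))) →
      determinantalComplexity (perPoly (Fin n) ℂ) ≤ 2 ^ ((Nat.log 2 m + c₁) ^ c₁)) ∧
    (∀ c : ℕ, ∃ n₀ : ℕ, ∀ n ≥ n₀,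
      2 ^ ((Nat.log 2 n + c) ^ c) < determinantalComplexity (perPoly (Fin n) ℂ))) :=
  ⟨fun hX => ⟨toricDeborderQPWindow_of_gctThesis (gctThesis_of_fixedWitnessObstructionQP hX),
      dcPerEventuallySuperQP_of_fixedWitnessObstructionQP hX⟩,
    fun h => fixedWitnessObstructionQP_of_noExtremalInitialForm hT
      (noExtremalInitialForm_of_toricDeborderQPWindow h.1 h.2)⟩

end Summit.ValiantsHypothesis.ValiantsHypothesis.Theorems.BorderApolarityFixedWitnessObstructionQP
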